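import Literature.AlgebraicGeometry.ShimuraVarieties.FramedConeChart
import Literature.AlgebraicGeometry.ComplexMultiplication.CMWeilSectionWeilTypeOfMarkman
import Literature.AlgebraicGeometry.ComplexMultiplication.CMWeilSectionFivefoldSupport
import Literature.AlgebraicGeometry.HodgeTheory.AbelianLowDimensionNonSimpleFivefoldsCodimTwo
import Literature.AlgebraicGeometry.ComplexMultiplication.SimpleFourfoldImaginaryCentre
import Literature.AlgebraicGeometry.HodgeTheory.EndAlgebraDegreeEightEvenMultiplicity
import Literature.AlgebraicGeometry.HodgeTheory.QuarticCMTimesCMCurveProductSpan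
import Literature.AlgebraicGeometry.HodgeTheory.EndFieldMultiplicitiesOfSubfield
import Literature.AlgebraicGeometry.HodgeTheory.UnitaryTwoOneTimesCMCurveSquareCodimTwo
import Literature.AlgebraicGeometry.HodgeTheory.SimpleOddPrimeDimensionHodgeClasses
import Literature.AlgebraicGeometry.HodgeTheory.GenericAbelianFivefoldPowersHodgeClasses
import HarnessLib

/-!
# Moonen–Zarhin 1999 Thm. 0.2, codimension two, for EVERY complex abelian fivefold — DISCHARGE of
# `MoonenZarhin1999_codimTwoHodgeClasses_abelianFivefold`: `B²(X) ⊆ D²(X) + Σ_α α^* B²(X')` (`α : X ↠ X'` onto fourfolds)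

The printed statement (Math. Ann. 315 (1999), Thm. 0.2 (i)–(iv) with (1.4) and (1.9), proof §5 (5.6)–(5.12)): for a complex abelian FIVEFOLD `X`,
«`B²(X) = D²(X) + Σ_α α^* B²(X')`», the sum over the surjective homomorphisms onto abelian fourfolds. The proof re-homed here
is the census of the Summits cell `Ring2`: (Part 1) CM fivefolds — weight lines descend from coordinate sub-products inside
pull-backs, a PAIR-RIGID CM-product fivefold satisfies the statement (the `(2,2)` weights are divisor pairs or Weil sections
of coordinate fourfolds, `CMWeilSectionFivefoldSupport`), hence EVERY fivefold of CM type does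
(`isCodimTwoDivisorPullbackGenerated_of_isOfCMType`), and the fact localises to fivefolds NOT of CM type, simple or in the
shapes (e)/(g); (Parts 2–5) the non-CM residual in Albert's terms: case (e) has `dim_ℚ End⁰(T) = 2`; the
quaternion-over-`k` cell of (γ) is EMPTY (no `(1,3)` multiplicities under a quaternion algebra over an imaginary quadratic
centre, `EndAlgebraDegreeEightEvenMultiplicity`); case (g) with `End⁰(X₂)` a quartic field is closed (`B•(X) = D•(X)` and
`HodgeConjectureFor` for such `X`, unconditionally: Tankeev / van Geemen); case (e) with `A₁`-type threefold is closed; so the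
fact is EQUIVALENT to its instances at the SIMPLE non-CM fivefolds (`…_iff_simple_not_isOfCMType`); (Part 6) `5` is prime:
a simple non-CM fivefold has `End⁰ = ℚ` (Tankeev–Ribet, Thm. (2.7)) or is of type IV(1) with multiplicities `(1,4)`
(Ribet's Thm. 3 at type one) or `(2,3)` (shape (S2), a theorem by the tree's unitary `Θ`-core
`RibetTypeTwoThreePowersHodgeClasses`), so the fact localises to the single shape (S1) `End⁰(X) = ℚ`; (Part 7) shape (S1)
is a theorem (`Lie Hg = 𝔰𝔭₁₀` and the invariant theory of `Sp`: the tree's `GenericAbelianFivefoldPowersHodgeClasses`,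
`AbelianVariety.isDivisorGenerated_of_fivefold_endRankOne`), whence
**`Literature.AlgebraicGeometry.HodgeTheory.MoonenZarhin1999_codimTwoHodgeClasses_abelianFivefold_holds`**, and the
`dim ≤ 5` reduction fact now follows from the FOURFOLD fact alone
(`moonenZarhin1999_hodgeClasses_abelian_dim_le_five_of_weilClassesFourfolds_of_fourfoldFact`).

WHAT IS NOT CLAIMED: Markman's Weil-class theorem is never asserted; the identification of the pull-backs with the Weil
classes `W_{k,α}` and the codimension-`3` part of Thm. 0.2 (1) are not formalised here; no case of the Hodge conjecture is
asserted beyond the cited `B = D` / `HodgeConjectureFor` theorems for the listed classes. Net named-fact debt −1.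

* Part 1 — from `Ring2/CMFivefoldsCodimTwo` (6/8 declarations; namespace
  `Literature.AlgebraicGeometry.HodgeTheory.AbelianLowDimension.CMFivefoldsCodimTwo`): MOONEN–ZARHIN Thm. 0.2 IN
  CODIMENSION 2 — `B²(X) ⊆ D²(X) + Σ_α α^* B²(X')` — FOR EVERY COMPLEX ABELIAN FIVEFOLD OF CM TYPE, UNCONDITIONALLY;
  the named fact `MoonenZarhin1999_codimTwoHodgeClasses_abelianFivefold` localised to fivefolds NOT of CM type.
  Declarations: `weightClassesAlg_map_le_span_image`, `isCodimTwoDivisorPullbackGenerated_biproduct_cm`,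
  `isCodimTwoDivisorPullbackGenerated_of_isOfCMType`, `not_isOfCMType_of_caseE`, `not_isOfCMType_of_caseG`,
  `moonenZarhin1999_codimTwoHodgeClasses_abelianFivefold_iff_residual_not_isOfCMType`.
* Part 2 — from `Ring2/NonCMFivefoldsCodimTwoResidual` (2/3 declarations; namespace
  `Literature.AlgebraicGeometry.HodgeTheory.AbelianLowDimension.NonCMFivefoldsCodimTwoResidual`): the residual of the
  fivefold fact `MoonenZarhin1999_codimTwoHodgeClasses_abelianFivefold` in ALBERT'S TERMS — case (e) with `End⁰(T) =
  k`, case (g) with `End⁰(F) ⊋ k` a quartic field or a quaternion algebra over `k`. Declarations: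
  `finrank_endAlgebra_eq_two_of_caseE`, `moonenZarhin1999_codimTwoHodgeClasses_abelianFivefold_iff_residual_albert`.
* Part 3 — from `Ring2/NonCMFivefoldsCodimTwoResidualQuartic` (3/4 declarations; namespace
  `Literature.AlgebraicGeometry.HodgeTheory.AbelianLowDimension.NonCMFivefoldsCodimTwoResidualQuartic`): the residual
  of the fivefold fact `MoonenZarhin1999_codimTwoHodgeClasses_abelianFivefold` — the quaternion-over-`k` cell of case
  (g) is EMPTY; case (g) remains only for `End⁰(F)` a QUARTIC FIELD. Declarations:
  `eigenMultiplicity_eq_of_isSimple_of_dim_eq_four_of_finrank_eq_eight`, `not_quaternionCell`,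
  `moonenZarhin1999_codimTwoHodgeClasses_abelianFivefold_iff_residual_quartic`.
* Part 4 — from `Ring2/CaseGQuarticFieldClosed` (2/7 declarations; namespace
  `Literature.AlgebraicGeometry.HodgeTheory.AbelianLowDimension.CaseGQuarticField`): Moonen–Zarhin 1999 Thm. 0.2 (3)
  case (g) with `End⁰(X₂)` a QUARTIC FIELD is CLOSED — the fivefold fact's residual is `[simple non-CM =
  Tankeev–Ribet] ∧ [(e) ∩ (a1)]`, and `HCUpToDim 5` modulo Markman and Tankeev–Ribet is `HC(row-four residual) ∧
  HC((e) ∩ …. Declarations: `hodgeConjectureFor_of_caseG_quarticField`,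
  `moonenZarhin1999_codimTwoHodgeClasses_abelianFivefold_iff_residual_caseE`.
* Part 5 — from `Ring2/CaseEA1Closed` (1/10 declarations; namespace
  `Literature.AlgebraicGeometry.HodgeTheory.AbelianLowDimension.CaseEA1`): Moonen–Zarhin 1999 Thm. 0.2 (1), case (e) ∩
  (a1), IS CLOSED in codimension two — the fivefold fact `MoonenZarhin1999_codimTwoHodgeClasses_abelianFivefold` is
  EQUIVALENT to its instances at the SIMPLE NON-CM fivefolds (Tankeev–Ribet shape) and FOLLOWS from …. Declarations:
  `moonenZarhin1999_codimTwoHodgeClasses_abelianFivefold_iff_simple_not_isOfCMType`.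
* Part 6 — from `Ring2/FivefoldFactTwoShapes` (5/13 declarations; namespace
  `Literature.AlgebraicGeometry.HodgeTheory.AbelianLowDimension.FivefoldFactTwoShapes`): the fivefold fact
  `MoonenZarhin1999_codimTwoHodgeClasses_abelianFivefold` is EQUIVALENT to TWO Hodge-group shapes on SIMPLE fivefolds
  — `End⁰ = ℚ` (symplectic, `Sp₁₀`) and `End⁰ = k` imaginary quadratic with multiplicities `(2,3)` (unitary) —,
  FOLLOWS from …. Declarations: `prime_five_and_odd`,
  `isCodimTwoDivisorPullbackGenerated_of_isSimple_of_not_isOfCMType_of_shapes`,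
  `moonenZarhin1999_codimTwoHodgeClasses_abelianFivefold_iff_generic_and_unitaryTwoThree`,
  `isCodimTwoDivisorPullbackGenerated_of_unitaryTwoThree`,
  `moonenZarhin1999_codimTwoHodgeClasses_abelianFivefold_iff_generic`.
* Part 7 — from `Ring2/FivefoldFactHolds` (3/10 declarations; namespace
  `Literature.AlgebraicGeometry.HodgeTheory.AbelianLowDimension.FivefoldFactHolds`): THE FIVEFOLD FACT HOLDS —
  Moonen–Zarhin 1999 Thm. 0.2 in codimension two, `MoonenZarhin1999_codimTwoHodgeClasses_abelianFivefold`, is a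
  THEOREM of the tree; `HCUpToDim 5` modulo Markman ALONE is the row-four residual. Declarations:
  `isCodimTwoDivisorPullbackGenerated_of_generic`, `moonenZarhin1999_codimTwoHodgeClasses_abelianFivefold_holds`,
  `moonenZarhin1999_hodgeClasses_abelian_dim_le_five_of_weilClassesFourfolds_of_fourfoldFact`.

## References

* [MoonenZarhin1999LowDim] B. Moonen, Yu. Zarhin, Math. Ann. 315 (1999) 711–733, Thm. 0.2 (1)–(4) (printed (i)–(iv)) with (1.4) and (1.9), §5 (5.1), (5.6)–(5.12) (arXiv v2 = Math. Ann. numbering: §2 ends with Thm. (2.7), there is no item (2.8); the `E × Y` Cases 1∕2 are (5.11) and the conclusions of Thm. 0.2 are (5.12) — earlier tree copies wrote «(2.8)», «(5.11) Case 2», «(5.11)» for these).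
* [Pohlmann1968] H. Pohlmann, Ann. of Math. 88 (1968), Thm. 1.
* [Shimura1998] G. Shimura, *Abelian Varieties with Complex Multiplication and Modular Functions* (1998), §8.2 Prop.
  26.
* [MumfordAV1970] D. Mumford, *Abelian Varieties* (1970), §19 Thm. 1, Cor. 1–2 (pp. 173–174) and Remark p. 169.
* [Deligne1982HodgeCycles] P. Deligne, LNM 900 (1982), §4 Prop. 4.4, §5 p. 63.
* [vanGeemen1994HodgeAV] B. van Geemen, LNM 1594 (1994), 4.9–4.10 and Lemma 5.2.
* [Milne2020HodgeClassesAV] J. S. Milne, *Hodge classes on abelian varieties* (2020), 1.2 (a).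
* [Milne1999] J. S. Milne, Compositio Math. 117 (1999), §2 p. 54.
* [SilvermanAEC2009] J. H. Silverman, GTM 106 (2009), III.9 Cor. 9.4.
* [Ribet1983] K. A. Ribet, Amer. J. Math. 105 (1983) (with Tankeev: simple abelian varieties of prime dimension).
* [Tankeev1983] S. G. Tankeev, *Cycles on simple abelian varieties of prime dimension*, Math. USSR-Izv. 20 (1983).
* [Deligne2000] P. Deligne, *The Hodge conjecture* (Clay problem description, 2000), §1.
* [Gordon1997] B. B. Gordon, *A survey of the Hodge conjecture for abelian varieties*, Thm. 6.3 and Corollary,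
  §1.13.3.
* [MoonenZarhin1995Duke] B. Moonen, Yu. Zarhin, Duke Math. J. 77 (1995), Thm. 2.4.

Provenance: Literature home of the used declarations of the Summits-side modules listed part by part above (cells
`pub-hodge-ring2` / `pub-hodgecm2`; namespaces `Summit.HodgeConjecture.Ring2.CMFivefoldsCodimTwo`,
`Summit.HodgeConjecture.Ring2.CaseEA1`, `Summit.HodgeConjecture.Ring2.CaseGQuarticField`,
`Summit.HodgeConjecture.Ring2.FivefoldFactHolds`, `Summit.HodgeConjecture.Ring2.FivefoldFactTwoShapes`,
`Summit.HodgeConjecture.Ring2.NonCMFivefoldsCodimTwoResidual`,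
`Summit.HodgeConjecture.Ring2.NonCMFivefoldsCodimTwoResidualQuartic` re-rooted under `Literature.AlgebraicGeometry.…`
as stated), whose imports are `Literature/` and Mathlib only for the declarations used; re-homed verbatim (proofs
unchanged) so that Literature users are served without importing `Summits/`. Lane `lit-hodgefound`, seat p20
(generation 34). Theorems only: no definition, no named fact, no `sorry`; axioms `propext`, `Classical.choice`,
`Quot.sound`.
-/

/-! ## Part 1: CMFivefoldsCodimTwo -/

noncomputable section

open _root_.CategoryTheory _root_.CategoryTheory.Limits NumberField

namespace Literature.AlgebraicGeometry.HodgeTheory.AbelianLowDimension.CMFivefoldsCodimTwo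

open Literature.AlgebraicGeometry.Motives (AbelianVariety CMType)
open Literature.AlgebraicGeometry.Motives.AbelianVariety
open Literature.AlgebraicGeometry.HodgeTheory
open Literature.AlgebraicGeometry.Pohlmann1968
open Literature.AlgebraicGeometry.ComplexMultiplication (IsCMTypeRealisation)
open Literature.AlgebraicGeometry.Milne1999 (IsOfCMType surjective_toSchemeHom_of_comp_eq_nsmul_id isOfCMType_iff_of_isIsogenous isOfCMType_prod_iff)
open Literature.AlgebraicTopology.SingularHomology
open Literature.NumberTheory.ComplexMultiplication
open Literature.AlgebraicGeometry.ComplexMultiplication.Domination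
open Literature.AlgebraicGeometry.ComplexMultiplication.CMWeights
open Literature.AlgebraicGeometry.HodgeTheory.AbelianLowDimension.NonSimpleFivefoldsCodimTwo

open scoped Classical Pointwise

section Biproduct

variable {m n : ℕ} {K : Fin n → Type} [∀ i, Field (K i)] [∀ i, NumberField (K i)] [∀ i, IsCMField (K i)]
variable {A : Fin n → AbelianVariety ℂ} {Φ : ∀ i, CMType (K i)} {ι : ∀ i, 𝓞 (K i) →+* End (A i)}
  {θ : ∀ i, K i →+* Module.End ℂ (complexBetti (A i).X 1)}

/-! ### §1 A weight line pulls back inside the pull-back of any span containing the small weight line -/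

omit [∀ i, IsCMField (K i)] in
/-- **Weight lines descend from a coordinate sub-product inside pull-backs**: if the weight line `H^k(B')_{S''}` of
`B' = ⨁_j A_{e j}` (`#S'' = k`) lies in `span_ℂ s`, the weight line `H^k(B)_{σ_e S''}` of `B = ⨁_i A_i` lies in
`span_ℂ (π_e^* s)` (it is the line of the non-zero pull-back `π_e^* c''` of a generator; the cell's
`weightClassesAlg_map_le_algebraicClasses` with `Nᵖ` replaced by a span). [cite: MoonenZarhin1999LowDim, Thm. 0.2 (i)–(iv) with (1.9)]
[cite: Milne2020HodgeClassesAV, 1.2 (a)] [cite: MumfordAV1970, §19] -/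
theorem weightClassesAlg_map_le_span_image (hA : ∀ i, IsCMTypeRealisation (Φ i) (A i) (ι i) (θ i))
    (e : Fin m → Fin n) (he : Function.Injective e) {k : ℕ} {S'' : Finset ((j : Fin m) × (K (e j) →+* ℂ))}
    (hS'' : S''.card = k) {s : Set (complexBetti (⨁ (fun j => A (e j))).X k)}
    (hle : weightClassesAlg (fun j => A (e j)) (fun j => ι (e j)) k S'' ≤ Submodule.span ℂ s) :
    weightClassesAlg A ι k (S''.map ⟨_, sigma_map_injective e he⟩) ≤
      Submodule.span ℂ ((fun c => complexBetti.map (biproduct.lift (fun j => biproduct.π A (e j)) :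
        (⨁ A) ⟶ ⨁ (fun j => A (e j))).hom.hom.hom k c) '' s) := by
  -- a non-zero generator of the small line and its (non-zero) pull-back
  obtain ⟨c'', hc''0, hline''⟩ :=
    exists_weightClassesAlg_eq_span_singleton (A := fun j => A (e j)) (Φ := fun j => Φ (e j))
      (ι := fun j => ι (e j)) (θ := fun j => θ (e j)) (fun j => hA (e j)) hS''
  set π : (⨁ A) ⟶ ⨁ (fun j => A (e j)) := biproduct.lift (fun j => biproduct.π A (e j)) with hπ
  have hc''mem : c'' ∈ weightClassesAlg (fun j => A (e j)) (fun j => ι (e j)) k S'' := by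
    rw [hline'']; exact Submodule.mem_span_singleton_self _
  have hpc_mem : complexBetti.map π.hom.hom.hom k c'' ∈ weightClassesAlg A ι k (S''.map ⟨_, sigma_map_injective e he⟩) :=
    map_mem_weightClassesAlg_of_mem e he hc''mem
  have hpc_ne : complexBetti.map π.hom.hom.hom k c'' ≠ 0 := fun h =>
    hc''0 (complexBetti_map_lift_π_injective e he k (by rw [h, map_zero]))
  have hpc_in : complexBetti.map π.hom.hom.hom k c'' ∈
      Submodule.span ℂ ((fun c => complexBetti.map π.hom.hom.hom k c) '' s) := by
    have h := Submodule.mem_map_of_mem (f := (complexBetti.map π.hom.hom.hom k).hom) (hle hc''mem)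
    rw [Submodule.map_span] at h
    exact h
  -- the big line is spanned by the pull-back
  have hScard : (S''.map ⟨_, sigma_map_injective e he⟩).card = k := by rw [Finset.card_map, hS'']
  obtain ⟨c, hc0, hline⟩ := exists_weightClassesAlg_eq_span_singleton hA hScard
  rw [hline] at hpc_mem ⊢
  obtain ⟨t, ht⟩ := Submodule.mem_span_singleton.1 hpc_mem
  have ht0 : t ≠ 0 := by rintro rfl; rw [zero_smul] at ht; exact hpc_ne ht.symm
  rw [Submodule.span_singleton_le_iff_mem]
  have hc_eq : c = t⁻¹ • complexBetti.map π.hom.hom.hom k c'' := by rw [← ht, smul_smul, inv_mul_cancel₀ ht0, one_smul]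
  rw [hc_eq]; exact Submodule.smul_mem _ _ hpc_in

/-! ### §2 Pair-rigid CM products of total dimension `5`: `B² ⊆ D² + Σ_α α^* B²(X')`, hypothesis-free -/

/-- **`B²(B) ⊗ ℂ ⊆ (D²(B) ⊗ ℂ) + span_ℂ {π^* w : π : B ↠ B' an abelian FOURFOLD, w a rational (2,2)-class}` for a
PAIR-RIGID CM-product fivefold `B = ⨁_i A_i`** — the CONCLUSION of `MoonenZarhin1999_codimTwoHodgeClasses_abelianFivefold`
at `B`, PROVED: by Pohlmann (`mem_iSup_weightClassesAlg`) and the fivefold dichotomy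
(`mem_pohlmannDivisorSetsAlg_two_or_weilSection_five`) a balanced `4`-weight `S` is a divisor monomial (line in `D² ⊗ ℂ`,
`divisorClassesSpan_biproduct_eq_iSup`) or `S = σ_e S''`, `S''` a WEIL SECTION of the coordinate FOURFOLD
`B' = ⨁_{i ≠ i₀} A_i` (`[K_{i₀}:ℚ] = 2`); then `(B', φ_{S''})` is of Weil type, its Weil plane contains the line of `S''`
(`isWeilType_of_weilSection`) and is the span of its RATIONAL classes, all of type `(2,2)`, so by §1 the line of `S` lies
in `span {π_e^* w}`, `π_e : B ⟶ B'` the projection (surjective: section `⊕_j ι_{e j}`).  The block `S = σ_e S''` is the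
cell's `weightClassesAlg_le_algebraicClasses_two_five_of_markman`, verbatim; Markman's theorem does not enter.
[cite: MoonenZarhin1999LowDim, Thm. 0.2 (i)–(iv) with (1.4) and (1.9), §5 (5.6)–(5.12)] [cite: Pohlmann1968, Thm. 1]
[cite: Deligne1982HodgeCycles, §4 Prop. 4.4] [cite: vanGeemen1994HodgeAV, 4.9–4.10 and Lemma 5.2] -/
theorem isCodimTwoDivisorPullbackGenerated_biproduct_cm (hA : ∀ i, IsCMTypeRealisation (Φ i) (A i) (ι i) (θ i))
    (h5 : (⨁ A).dim = 5)
    (hrig : ∀ x y : (i : Fin n) × (K i →+* ℂ), x.1 = y.1 → x ≠ y →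
      IsGaloisBalancedAlg Φ ({x} ∪ ({y} : Finset _)) → y = (starRingAut : ℂ ≃+* ℂ) • x) :
    IsCodimTwoDivisorPullbackGenerated (⨁ A) := by
  intro c hcQ hcH
  have h10 : ∑ i, Module.finrank ℚ (K i) = 10 := by rw [sum_finrank_eq_two_mul_dim hA, h5]
  refine (iSup₂_le fun S hS => ?_ :
    (⨆ S ∈ pohlmannSetsAlg Φ 2, weightClassesAlg A ι (2 * 2) S) ≤ _) (mem_iSup_weightClassesAlg hA hcQ hcH)
  rcases mem_pohlmannDivisorSetsAlg_two_or_weilSection_five h10 Φ hrig hS with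
    hD | ⟨hsec, x₀, hx₀, hx₀', hcov, hτ⟩
  · -- a divisor monomial: its line lies in `D² ⊗ ℂ`
    refine le_trans ?_ le_sup_left
    rw [divisorClassesSpan_biproduct_eq_iSup hA 2]
    exact le_iSup₂_of_le S hD le_rfl
  -- the block `i₀ = x₀.1` is `{x₀, ρ x₀}`: an imaginary quadratic field
  have hblock : ∀ s : K x₀.1 →+* ℂ, (⟨x₀.1, s⟩ : (i : Fin n) × (K i →+* ℂ)) = x₀ ∨
      (⟨x₀.1, s⟩ : (i : Fin n) × (K i →+* ℂ)) = (starRingAut : ℂ ≃+* ℂ) • x₀ := by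
    intro s
    haveI : Countable (K x₀.1) := countable_field x₀.1
    obtain ⟨τ, hτs⟩ := Literature.AlgebraicGeometry.Motives.ZarhinLie.exists_ringEquiv_complex_comp_eq x₀.2 s
    have hτx : τ • x₀ = ⟨x₀.1, s⟩ := by
      rw [smul_sigma_eq]
      exact congrArg (Sigma.mk x₀.1) (RingHom.ext fun b => hτs b)
    rw [← hτx]
    exact (hτ τ).1
  have hnot_block : ∀ x ∈ S, x.1 ≠ x₀.1 := by
    intro x hx h
    obtain ⟨i, s⟩ := x
    change i = x₀.1 at h
    subst h
    rcases hblock s with h' | h'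
    · exact hx₀ (h' ▸ hx)
    · exact hx₀' (h' ▸ hx)
  have hK₀ : Module.finrank ℚ (K x₀.1) = 2 := by
    rw [← Embeddings.card (K x₀.1) ℂ]
    have hne : ComplexEmbedding.conjugate x₀.2 ≠ x₀.2 := by
      intro h
      apply conj_smul_ne_self Φ x₀
      rw [conj_smul_sigma_eq]
      exact congrArg (Sigma.mk x₀.1) h
    apply le_antisymm
    · -- every embedding is `x₀.2` or its conjugate
      have hsub : (Finset.univ : Finset (K x₀.1 →+* ℂ)) ⊆ {x₀.2, ComplexEmbedding.conjugate x₀.2} := by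
        intro s _
        rw [Finset.mem_insert, Finset.mem_singleton]
        rcases hblock s with h | h
        · exact Or.inl (eq_of_heq (Sigma.mk.inj_iff.1 h).2)
        · right
          rw [conj_smul_sigma_eq] at h
          exact eq_of_heq (Sigma.mk.inj_iff.1 h).2
      calc Fintype.card (K x₀.1 →+* ℂ) = (Finset.univ : Finset (K x₀.1 →+* ℂ)).card := Finset.card_univ.symm
        _ ≤ ({x₀.2, ComplexEmbedding.conjugate x₀.2} : Finset _).card := Finset.card_le_card hsub
        _ ≤ 2 := Finset.card_le_two
    · calc 2 = ({x₀.2, ComplexEmbedding.conjugate x₀.2} : Finset _).card := by rw [Finset.card_pair hne.symm]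
        _ ≤ Fintype.card (K x₀.1 →+* ℂ) := Finset.card_le_univ _
  -- re-index the other blocks by `Fin n'`, `n = n' + 1`
  obtain ⟨n', rfl⟩ : ∃ n', n = n' + 1 := ⟨n - 1, by have := x₀.1.pos; omega⟩
  set e : Fin n' → Fin (n' + 1) := x₀.1.succAbove with he_def
  have he : Function.Injective e := Fin.succAbove_right_injective
  have he₀ : ∀ j, e j ≠ x₀.1 := fun j => Fin.succAbove_ne x₀.1 j
  set emb : ((j : Fin n') × (K (e j) →+* ℂ)) ↪ ((i : Fin (n' + 1)) × (K i →+* ℂ)) :=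
    ⟨_, sigma_map_injective e he⟩ with hemb
  -- `S = σ_e(S'')`
  set S'' : Finset ((j : Fin n') × (K (e j) →+* ℂ)) := S.preimage emb emb.injective.injOn with hS''
  have hSmap : S''.map emb = S := by
    ext x
    simp only [Finset.mem_map, hS'', Finset.mem_preimage]
    constructor
    · rintro ⟨y, hy, rfl⟩; exact hy
    · intro hx
      obtain ⟨j, hj⟩ := Fin.exists_succAbove_eq (hnot_block x hx)
      obtain ⟨i, s⟩ := x
      change x₀.1.succAbove j = i at hj
      subst hj
      exact ⟨⟨j, s⟩, hx, rfl⟩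
  have hS''card : S''.card = 2 * 2 := by rw [← Finset.card_map emb, hSmap]; exact hS.1
  -- the sub-family: total dimension `4`
  have hA'' : ∀ j, IsCMTypeRealisation (Φ (e j)) (A (e j)) (ι (e j)) (θ (e j)) := fun j => hA (e j)
  have h8 : ∑ j, Module.finrank ℚ (K (e j)) = 8 := by
    have hsum := Fin.sum_univ_succAbove (fun i => Module.finrank ℚ (K i)) x₀.1
    rw [h10, hK₀] at hsum
    change 10 = 2 + ∑ j, Module.finrank ℚ (K (e j)) at hsum
    omega
  have hdim'' : (⨁ fun j => A (e j)).dim = 2 * 2 := by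
    have h := sum_finrank_eq_two_mul_dim (A := fun j => A (e j)) (Φ := fun j => Φ (e j)) (ι := fun j => ι (e j))
      (θ := fun j => θ (e j)) hA''
    omega
  -- `S''` is a Weil section of the sub-family
  have hS''mem : S'' ∈ pohlmannSetsAlg (fun j => Φ (e j)) 2 :=
    ⟨hS''card, isGaloisBalancedAlg_comap e he Φ (hSmap.symm ▸ hS.2)⟩
  have hmem_iff : ∀ y : (j : Fin n') × (K (e j) →+* ℂ), y ∈ S'' ↔ emb y ∈ S := fun y => by
    rw [← hSmap, Finset.mem_map' emb]
  have hemb_conj : ∀ y : (j : Fin n') × (K (e j) →+* ℂ),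
      emb ((starRingAut : ℂ ≃+* ℂ) • y) = (starRingAut : ℂ ≃+* ℂ) • emb y := fun _ => rfl
  have hsec'' : ∀ y ∈ S'', (starRingAut : ℂ ≃+* ℂ) • y ∉ S'' := by
    intro y hy hy'
    rw [hmem_iff] at hy hy'; rw [hemb_conj] at hy'
    exact hsec _ hy hy'
  have hfull'' : ∀ y : (j : Fin n') × (K (e j) →+* ℂ), y ∈ S'' ∨ (starRingAut : ℂ ≃+* ℂ) • y ∈ S'' := by
    intro y
    rw [hmem_iff, hmem_iff, hemb_conj]
    rcases hcov (emb y) with h | h | h | h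
    · exact Or.inl h
    · exact Or.inr h
    · exact absurd (congrArg Sigma.fst h) (he₀ y.1)
    · have h' := congrArg Sigma.fst h
      rw [conj_smul_sigma_eq] at h'
      exact absurd h' (he₀ y.1)
  have hW'' : ∀ τ : ℂ ≃+* ℂ, τ • S'' = S'' ∨ τ • S'' = (starRingAut : ℂ ≃+* ℂ) • S'' := by
    intro τ
    rcases (hτ τ).2 with h | h
    · left
      apply Finset.map_injective emb
      rw [← smul_finset_map_sigma e he τ S'', hSmap, h]
    · right
      apply Finset.map_injective emb
      rw [← smul_finset_map_sigma e he τ S'', ← smul_finset_map_sigma e he _ S'', hSmap, h]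
  -- `(B', φ_{S''})` is a pair of Weil type; its Weil plane contains the line of `S''` and is spanned by its rational
  -- classes, all of Hodge type `(2,2)`
  obtain ⟨d, a, hd, hφ, hle, hWT⟩ := isWeilType_of_weilSection hA'' (by norm_num) hdim'' hS''mem hsec'' hfull'' hW''
  rw [weilClassesOf_eq_span_isRationalClass (by norm_num) hdim'' hd hφ] at hle
  -- the projection `π_e : B ⟶ B'` is surjective (it has the section `⊕_j ι_{e j}`)
  have hπs : _root_.AlgebraicGeometry.Surjective (AbelianVariety.Hom.toSchemeHom
      (biproduct.lift (fun j => biproduct.π A (e j)) : (⨁ A) ⟶ ⨁ (fun j => A (e j)))) :=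
    surjective_toSchemeHom_of_comp_eq_nsmul_id (biproduct.desc (fun j => biproduct.ι A (e j))) _ one_ne_zero
      (by rw [biproduct_desc_ι_comp_lift_π e he, one_smul])
  -- the line of `S = σ_e S''` lies in the span of the pull-backs of the rational Weil classes of `B'`
  have h := weightClassesAlg_map_le_span_image hA e he hS''card hle
  rw [hSmap] at h
  refine h.trans (le_trans (Submodule.span_mono ?_) le_sup_right)
  rintro _ ⟨w, ⟨hwQ, hwW⟩, rfl⟩
  refine ⟨⨁ (fun j => A (e j)), biproduct.lift (fun j => biproduct.π A (e j)), w, by omega, hπs, hwQ, ?_, rfl⟩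
  rw [hdim'']
  exact hWT.isOfHodgeType_of_mem_weilClassesOf hwW

end Biproduct

/-! ### §3 Every complex abelian fivefold of CM type -/

variable {X : AbelianVariety ℂ}

/-- **MOONEN–ZARHIN Thm. 0.2 IN CODIMENSION 2 FOR EVERY COMPLEX ABELIAN FIVEFOLD OF CM TYPE — UNCONDITIONAL:
`B²(X) ⊆ D²(X) + Σ_α α^* B²(X')`** (simple or not; in particular the CM members `E × E × T` of case (e) and `F × C` of
case (g)).  `X ∼ B`, a product of SIMPLE CM-typed varieties (`exists_isProductOf_simple_cmTyped`), dominated by — being of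
the same dimension, isogenous to — a biproduct of simple realisations (`exists_simple_biproduct_family_of_isProductOf`),
pair-rigid by Shimura's Prop. 26 (`eq_conj_smul_of_isGaloisBalancedAlg_pair_of_isSimple`); §2 and isogeny invariance.
[cite: MoonenZarhin1999LowDim, Thm. 0.2 (i)–(iv) with (1.4) and (1.9), §5 (5.6)–(5.12)] [cite: Pohlmann1968, Thm. 1]
[cite: Shimura1998, §8.2 Prop. 26 (p. 63), §5.1 Props. 3–6 and §7.1] [cite: MumfordAV1970, §19 Thm. 1 and Remark p. 169] -/
theorem isCodimTwoDivisorPullbackGenerated_of_isOfCMType (hX5 : X.dim = 5) (hcm : IsOfCMType X) :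
    IsCodimTwoDivisorPullbackGenerated X := by
  obtain ⟨B, hB, hXB⟩ := exists_isProductOf_simple_cmTyped X (by omega) hcm
  obtain ⟨n, K, iF, iN, iC, C, Φ, ι, θ, hC, hsC, hdom, hdim⟩ := exists_simple_biproduct_family_of_isProductOf hB
  have hBdim : B.dim = 5 := by obtain ⟨g, hg⟩ := hXB; rw [← dim_eq_of_isIsogeny hg, hX5]
  have hCdim : (⨁ C).dim = 5 := hdim.trans hBdim
  have hP : IsCodimTwoDivisorPullbackGenerated (⨁ C) :=
    isCodimTwoDivisorPullbackGenerated_biproduct_cm hC hCdim (eq_conj_smul_of_isGaloisBalancedAlg_pair_of_isSimple hC hsC)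
  obtain ⟨s, π, N, hN, hsπ⟩ := hdom
  have hs : AbelianVariety.IsIsogeny s :=
    isIsogeny_of_comp_eq_nsmul_id (K := ℂ) (Nat.cast_ne_zero.2 hN) hsπ (hBdim.trans hCdim.symm)
  exact (hP.of_isIsogeny hs).of_isIsogenous hXB

/-! ### §4 The named fact localised to fivefolds not of CM type -/

/-- In case (e), if `X ∼ E × (E × T)` is NOT of CM type then `T` is not (`E` is; CM type is stable under products and
isogeny). [cite: Deligne1982HodgeCycles, §5 p. 63] [cite: Milne1999, §2 p. 54] -/
theorem not_isOfCMType_of_caseE {E T : AbelianVariety ℂ} (hX : ¬ IsOfCMType X) (hE : IsOfCMType E)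
    (hXE : AbelianVariety.IsIsogenous X (E.prod (E.prod T))) : ¬ IsOfCMType T := fun hT =>
  hX ((isOfCMType_iff_of_isIsogenous hXE).2 (isOfCMType_prod_iff.2 ⟨hE, isOfCMType_prod_iff.2 ⟨hE, hT⟩⟩))

/-- In case (g), if `X ∼ F × C` is NOT of CM type and the elliptic curve `C` carries `χ ≫ χ = -d'` (`d' > 0`), then
`F` is not of CM type (`C` is, Silverman III.9). [cite: SilvermanAEC2009, III.9 Cor. 9.4] [cite: Milne1999, §2 p. 54] -/
theorem not_isOfCMType_of_caseG {F C : AbelianVariety ℂ} (hX : ¬ IsOfCMType X) (hC : C.dim = 1) {χ : C ⟶ C}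
    {d' : ℕ} (hd' : 0 < d') (hχ : χ ≫ χ = -(d' • 𝟙 C)) (hXF : AbelianVariety.IsIsogenous X (F.prod C)) :
    ¬ IsOfCMType F := fun hF =>
  hX ((isOfCMType_iff_of_isIsogenous hXF).2
    (isOfCMType_prod_iff.2 ⟨hF, isOfCMType_of_hom_comp_self_eq_neg hC hd' hχ⟩))

/-- **LOCALISATION OF THE NAMED FACT, REFINED.** `MoonenZarhin1999_codimTwoHodgeClasses_abelianFivefold` is
EQUIVALENT to its instances at fivefolds NOT OF CM TYPE in the three residual classes: (α) SIMPLE non-CM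
[Tankeev–Ribet]; (β) case (e) `X ∼ E × (E × T)` with the simple threefold `T` NOT of CM type [Thm. 0.2 (1)]; (γ) the
residual of case (g) `X ∼ F × C` with the simple fourfold `F` NOT of CM type (`C` a CM curve `χ ≫ χ = -d'`, a central
unbalanced `φ` on `F` with `φ ≫ φ = -(M²d')`, `dim_ℚ End⁰(F) ≠ 2`) [Thm. 0.2 (3), `End⁰(X₂) ⊋ k`]; CM fivefolds: §3;
the rest: the companion census. [cite: MoonenZarhin1999LowDim, Thm. 0.2 (1)–(4) and §5 (5.1), (5.12)] [cite: Pohlmann1968, Thm. 1] -/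
theorem moonenZarhin1999_codimTwoHodgeClasses_abelianFivefold_iff_residual_not_isOfCMType :
    MoonenZarhin1999_codimTwoHodgeClasses_abelianFivefold ↔
      (∀ A : AbelianVariety ℂ, A.dim = 5 → A.IsSimple → ¬ IsOfCMType A → IsCodimTwoDivisorPullbackGenerated A) ∧
      (∀ A : AbelianVariety ℂ, A.dim = 5 →
        (∃ E T : AbelianVariety ℂ, E.dim = 1 ∧ IsOfCMType E ∧ T.IsSimple ∧ T.dim = 3 ∧ ¬ IsOfCMType T ∧
          Nonempty (E.endAlgebra →+* T.endAlgebra) ∧ AbelianVariety.IsIsogenous A (E.prod (E.prod T))) →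
        IsCodimTwoDivisorPullbackGenerated A) ∧
      (∀ A : AbelianVariety ℂ, A.dim = 5 →
        (∃ (F C : AbelianVariety ℂ), F.IsSimple ∧ F.dim = 4 ∧ ¬ IsOfCMType F ∧ C.dim = 1 ∧
          AbelianVariety.IsIsogenous A (F.prod C) ∧
          ∃ (χ : C ⟶ C) (d' : ℕ), 0 < d' ∧ χ ≫ χ = -(d' • 𝟙 C) ∧ ∃ (φ : F ⟶ F) (M : ℕ), 0 < M ∧
          φ ≫ φ = -((M * M * d') • 𝟙 F) ∧ AbelianVariety.endAlgebra.of F φ ∈ Subalgebra.center ℚ F.endAlgebra ∧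
          eigenMultiplicity F φ (Complex.I * (Real.sqrt (M * M * d' : ℕ) : ℂ)) ≠
            eigenMultiplicity F φ (-(Complex.I * (Real.sqrt (M * M * d' : ℕ) : ℂ))) ∧
          Module.finrank ℚ F.endAlgebra ≠ 2) →
        IsCodimTwoDivisorPullbackGenerated A) := by
  refine ⟨fun h => ⟨fun A hA _ _ => h A hA, fun A hA _ => h A hA, fun A hA _ => h A hA⟩, fun ⟨hS, hE, hG⟩ A hA => ?_⟩
  by_cases hcm : IsOfCMType A
  · exact isCodimTwoDivisorPullbackGenerated_of_isOfCMType hA hcm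
  by_cases hs : A.IsSimple
  · exact hS A hA hs hcm
  by_cases hcaseE : ∃ E T : AbelianVariety ℂ, E.dim = 1 ∧ IsOfCMType E ∧ T.IsSimple ∧ T.dim = 3 ∧
      Nonempty (E.endAlgebra →+* T.endAlgebra) ∧ AbelianVariety.IsIsogenous A (E.prod (E.prod T))
  · obtain ⟨E, T, hE1, hEcm, hTs, hT3, hj, hAET⟩ := hcaseE
    exact hE A hA ⟨E, T, hE1, hEcm, hTs, hT3, not_isOfCMType_of_caseE hcm hEcm hAET, hj, hAET⟩
  by_cases hcaseG : ∃ (F C : AbelianVariety ℂ), F.IsSimple ∧ F.dim = 4 ∧ ¬ IsOfCMType F ∧ C.dim = 1 ∧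
      AbelianVariety.IsIsogenous A (F.prod C) ∧
      ∃ (χ : C ⟶ C) (d' : ℕ), 0 < d' ∧ χ ≫ χ = -(d' • 𝟙 C) ∧ ∃ (φ : F ⟶ F) (M : ℕ), 0 < M ∧
      φ ≫ φ = -((M * M * d') • 𝟙 F) ∧ AbelianVariety.endAlgebra.of F φ ∈ Subalgebra.center ℚ F.endAlgebra ∧
      eigenMultiplicity F φ (Complex.I * (Real.sqrt (M * M * d' : ℕ) : ℂ)) ≠
        eigenMultiplicity F φ (-(Complex.I * (Real.sqrt (M * M * d' : ℕ) : ℂ))) ∧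
      Module.finrank ℚ F.endAlgebra ≠ 2
  · exact hG A hA hcaseG
  refine isCodimTwoDivisorPullbackGenerated_of_dim_eq_five_of_not_isSimple hA hs ?_ hcaseE
  intro F C hFs hF4 hC hAFC χ d' hd' hχ φ M hM hφ hφZ hneq
  by_contra h2
  exact hcaseG ⟨F, C, hFs, hF4, not_isOfCMType_of_caseG hcm hC hd' hχ hAFC, hC, hAFC, χ, d', hd', hχ, φ, M, hM, hφ,
    hφZ, hneq, h2⟩

end Literature.AlgebraicGeometry.HodgeTheory.AbelianLowDimension.CMFivefoldsCodimTwo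

end

/-! ## Part 2: NonCMFivefoldsCodimTwoResidual -/

noncomputable section

open _root_.CategoryTheory _root_.CategoryTheory.Limits

namespace Literature.AlgebraicGeometry.HodgeTheory.AbelianLowDimension.NonCMFivefoldsCodimTwoResidual

open Literature.AlgebraicGeometry.ComplexMultiplication.Domination

open Literature.AlgebraicGeometry.Motives (AbelianVariety)
open Literature.AlgebraicGeometry.Motives.AbelianVariety
open Literature.AlgebraicGeometry.HodgeTheory
open Literature.AlgebraicGeometry.ComplexMultiplication (isField_or_finrank_eq_eight_of_dim_eq_four_of_not_isOfCMType_of_hom)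
open Literature.AlgebraicGeometry.Milne1999 (IsOfCMType)
open Literature.AlgebraicGeometry.HodgeTheory.AbelianLowDimension.CMFivefoldsCodimTwo

variable {X : AbelianVariety ℂ}

/-! ### §1 Case (e) with `T` not of CM type is case (e) ∩ (a1): `End⁰(T) = k` -/

/-- **In case (e), `T` NOT of CM type means `dim_ℚ End⁰(T) = 2`** (`End⁰(E) = k ↪ End⁰(T)`, `T` a simple threefold:
`End⁰(T)` is `k` or a sextic CM field `⊇ k`, the latter being CM type — Moonen–Zarhin (2.4), the tree's
`finrank_endAlgebra_eq_two_or_isOfCMType_of_dim_eq_three_of_ringHom`; the complex multiplication `χ` of `E` from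
`EllipticCurve.isOfCMType_iff_exists_mul_self_eq_neg`). [cite: MoonenZarhin1999LowDim, §2 (2.4) and §5 (5.3)]
[cite: SilvermanAEC2009, III.9 Cor. 9.4] -/
theorem finrank_endAlgebra_eq_two_of_caseE {E T : AbelianVariety ℂ} (hE1 : E.dim = 1) (hEcm : IsOfCMType E)
    (hTs : T.IsSimple) (hT3 : T.dim = 3) (hT : ¬ IsOfCMType T) (j : E.endAlgebra →+* T.endAlgebra) :
    Module.finrank ℚ T.endAlgebra = 2 := by
  obtain ⟨χ, d, hd, hχ⟩ :=
    (Literature.NumberTheory.ComplexMultiplication.EllipticCurve.isOfCMType_iff_exists_mul_self_eq_neg hE1).1 hEcm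
  have hχ' : χ ≫ χ = -(d • 𝟙 E) := by
    rw [← CategoryTheory.End.mul_def, hχ, ← nsmul_one d]
    rfl
  exact (finrank_endAlgebra_eq_two_or_isOfCMType_of_dim_eq_three_of_ringHom hTs hT3 hd hχ' j).resolve_right hT

/-! ### §2 The residual in Albert's terms -/

/-- **LOCALISATION OF THE NAMED FACT IN ALBERT'S TERMS.** `MoonenZarhin1999_codimTwoHodgeClasses_abelianFivefold` is
EQUIVALENT to its instances at: (α) the SIMPLE fivefolds NOT of CM type [Tankeev–Ribet]; (β) case (e) ∩ (a1) —
`X ∼ E × (E × T)`, `E` a CM elliptic curve, `T` a simple threefold NOT of CM type with `dim_ℚ End⁰(T) = 2` (`= k`) and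
`End⁰(E) ↪ End⁰(T)` [Thm. 0.2 (1)]; (γ) case (g) with `End⁰(F) ⊋ k` — `X ∼ F × C`, `C` an elliptic curve with
`χ ≫ χ = -d'`, `F` a simple fourfold NOT of CM type with `End⁰(F)` a quartic FIELD or `[End⁰(F):ℚ] = 8` with centre of
degree `2`, a CENTRAL `φ` on `F` with `φ ≫ φ = -(M²d')` of unbalanced multiplicities, `dim_ℚ End⁰(F) ≠ 2` [Thm. 0.2 (3)].
[cite: MoonenZarhin1999LowDim, Thm. 0.2 (1)–(4), §2 (2.4) and §5 (5.1), (5.12)] [cite: MumfordAV1970, §21 (pp. 201–202)] -/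
theorem moonenZarhin1999_codimTwoHodgeClasses_abelianFivefold_iff_residual_albert :
    MoonenZarhin1999_codimTwoHodgeClasses_abelianFivefold ↔
      (∀ A : AbelianVariety ℂ, A.dim = 5 → A.IsSimple → ¬ IsOfCMType A → IsCodimTwoDivisorPullbackGenerated A) ∧
      (∀ A : AbelianVariety ℂ, A.dim = 5 →
        (∃ E T : AbelianVariety ℂ, E.dim = 1 ∧ IsOfCMType E ∧ T.IsSimple ∧ T.dim = 3 ∧
          Module.finrank ℚ T.endAlgebra = 2 ∧ ¬ IsOfCMType T ∧
          Nonempty (E.endAlgebra →+* T.endAlgebra) ∧ AbelianVariety.IsIsogenous A (E.prod (E.prod T))) →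
        IsCodimTwoDivisorPullbackGenerated A) ∧
      (∀ A : AbelianVariety ℂ, A.dim = 5 →
        (∃ (F C : AbelianVariety ℂ), F.IsSimple ∧ F.dim = 4 ∧ ¬ IsOfCMType F ∧
          ((IsField F.endAlgebra ∧ Module.finrank ℚ F.endAlgebra = 4) ∨
            (Module.finrank ℚ F.endAlgebra = 8 ∧ Module.finrank ℚ (Subalgebra.center ℚ F.endAlgebra) = 2)) ∧
          C.dim = 1 ∧ AbelianVariety.IsIsogenous A (F.prod C) ∧
          ∃ (χ : C ⟶ C) (d' : ℕ), 0 < d' ∧ χ ≫ χ = -(d' • 𝟙 C) ∧ ∃ (φ : F ⟶ F) (M : ℕ), 0 < M ∧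
          φ ≫ φ = -((M * M * d') • 𝟙 F) ∧ AbelianVariety.endAlgebra.of F φ ∈ Subalgebra.center ℚ F.endAlgebra ∧
          eigenMultiplicity F φ (Complex.I * (Real.sqrt (M * M * d' : ℕ) : ℂ)) ≠
            eigenMultiplicity F φ (-(Complex.I * (Real.sqrt (M * M * d' : ℕ) : ℂ))) ∧
          Module.finrank ℚ F.endAlgebra ≠ 2) →
        IsCodimTwoDivisorPullbackGenerated A) := by
  rw [moonenZarhin1999_codimTwoHodgeClasses_abelianFivefold_iff_residual_not_isOfCMType]
  refine ⟨fun ⟨hS, hE, hG⟩ => ⟨hS, fun A hA ⟨E, T, hE1, hEcm, hTs, hT3, _, hT, hj, hAET⟩ =>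
      hE A hA ⟨E, T, hE1, hEcm, hTs, hT3, hT, hj, hAET⟩, fun A hA ⟨F, C, hFs, hF4, hF, _, hrest⟩ =>
      hG A hA ⟨F, C, hFs, hF4, hF, hrest⟩⟩, fun ⟨hS, hE, hG⟩ => ⟨hS, ?_, ?_⟩⟩
  · rintro A hA ⟨E, T, hE1, hEcm, hTs, hT3, hT, ⟨j⟩, hAET⟩
    exact hE A hA ⟨E, T, hE1, hEcm, hTs, hT3, finrank_endAlgebra_eq_two_of_caseE hE1 hEcm hTs hT3 hT j, hT, ⟨j⟩,
      hAET⟩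
  · rintro A hA ⟨F, C, hFs, hF4, hF, hC, hAFC, χ, d', hd', hχ, φ, M, hM, hφ, hφZ, hneq, h2⟩
    exact hG A hA ⟨F, C, hFs, hF4, hF,
      isField_or_finrank_eq_eight_of_dim_eq_four_of_not_isOfCMType_of_hom hFs hF4 hF φ
        (Nat.mul_pos (Nat.mul_pos hM hM) hd') hφ hφZ h2,
      hC, hAFC, χ, d', hd', hχ, φ, M, hM, hφ, hφZ, hneq, h2⟩

end Literature.AlgebraicGeometry.HodgeTheory.AbelianLowDimension.NonCMFivefoldsCodimTwoResidual

end

/-! ## Part 3: NonCMFivefoldsCodimTwoResidualQuartic -/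

noncomputable section

open _root_.CategoryTheory _root_.CategoryTheory.Limits

namespace Literature.AlgebraicGeometry.HodgeTheory.AbelianLowDimension.NonCMFivefoldsCodimTwoResidualQuartic

open Literature.AlgebraicGeometry.ComplexMultiplication.Domination

open Literature.AlgebraicGeometry.Motives (AbelianVariety)
open Literature.AlgebraicGeometry.Motives.AbelianVariety
open Literature.AlgebraicGeometry.HodgeTheory
open Literature.AlgebraicGeometry.Milne1999 (IsOfCMType)
open Literature.AlgebraicGeometry.HodgeTheory.AbelianLowDimension.CMFivefoldsCodimTwo
open Literature.AlgebraicGeometry.HodgeTheory.AbelianLowDimension.NonCMFivefoldsCodimTwoResidual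
open Literature.AlgebraicGeometry.HodgeTheory.EndAlgebraDegreeEightEvenMultiplicity

/-! ### §1 A quaternion algebra over the centre forces balanced multiplicities on a simple fourfold -/

/-- **No `(1,3)` under a quaternion algebra over `k`.** On a SIMPLE fourfold `F` with `[End⁰(F):ℚ] = 8` and centre of
degree `2`, a CENTRAL `φ` with `φ ≫ φ = -d` (`d > 0`) acts on `H^{1,0}(F)` with EQUAL multiplicities: both are even
(`even_eigenMultiplicity_of_isSimple_of_finrank_eq_eight_of_finrank_center_eq_two`), positive (Shimura, the tree's
`AbelianVariety.eigenMultiplicity_pos_of_isSimple`) and sum to `4`. [cite: MoonenZarhin1999LowDim, §5 (5.11) Case 2 and §1 (1.1)]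
[cite: MumfordAV1970, §19 Cor. 2 and §21 (pp. 201–202)] -/
theorem eigenMultiplicity_eq_of_isSimple_of_dim_eq_four_of_finrank_eq_eight {F : AbelianVariety ℂ} (hFs : F.IsSimple)
    (hF4 : F.dim = 4) (h8 : Module.finrank ℚ F.endAlgebra = 8)
    (hZ2 : Module.finrank ℚ ↥(Subalgebra.center ℚ F.endAlgebra) = 2) (φ : F ⟶ F) {d : ℕ} (hd : 0 < d)
    (hφ : φ ≫ φ = -(d • 𝟙 F)) (hφZ : AbelianVariety.endAlgebra.of F φ ∈ Subalgebra.center ℚ F.endAlgebra) :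
    eigenMultiplicity F φ (Complex.I * (Real.sqrt d : ℂ)) = eigenMultiplicity F φ (-(Complex.I * (Real.sqrt d : ℂ))) := by
  have hsum := eigenMultiplicity_add_eigenMultiplicity_neg_eq_dim F φ hd hφ
  obtain ⟨ha, hb⟩ := AbelianVariety.eigenMultiplicity_pos_of_isSimple F hFs φ hd hφ (by omega)
  obtain ⟨a, ha2⟩ := even_eigenMultiplicity_of_isSimple_of_finrank_eq_eight_of_finrank_center_eq_two hFs h8 hZ2 hφZ
    (Complex.I * (Real.sqrt d : ℂ))
  obtain ⟨b, hb2⟩ := even_eigenMultiplicity_of_isSimple_of_finrank_eq_eight_of_finrank_center_eq_two hFs h8 hZ2 hφZ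
    (-(Complex.I * (Real.sqrt d : ℂ)))
  omega

/-- **The quaternion-over-`k` cell of (γ) is EMPTY**: no simple fourfold `F` with `[End⁰(F):ℚ] = 8`, centre of degree
`2`, carries a central `φ`, `φ ≫ φ = -(M²d')`, of UNBALANCED multiplicities. [cite: MoonenZarhin1999LowDim, §5 (5.11) Case 2]
[cite: MumfordAV1970, §21 (pp. 201–202)] -/
theorem not_quaternionCell {F : AbelianVariety ℂ} (hFs : F.IsSimple) (hF4 : F.dim = 4)
    (h8 : Module.finrank ℚ F.endAlgebra = 8) (hZ2 : Module.finrank ℚ ↥(Subalgebra.center ℚ F.endAlgebra) = 2)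
    {φ : F ⟶ F} {M d' : ℕ} (hM : 0 < M) (hd' : 0 < d') (hφ : φ ≫ φ = -((M * M * d') • 𝟙 F))
    (hφZ : AbelianVariety.endAlgebra.of F φ ∈ Subalgebra.center ℚ F.endAlgebra)
    (hneq : eigenMultiplicity F φ (Complex.I * (Real.sqrt (M * M * d' : ℕ) : ℂ)) ≠
      eigenMultiplicity F φ (-(Complex.I * (Real.sqrt (M * M * d' : ℕ) : ℂ)))) : False :=
  hneq (eigenMultiplicity_eq_of_isSimple_of_dim_eq_four_of_finrank_eq_eight hFs hF4 h8 hZ2 φ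
    (Nat.mul_pos (Nat.mul_pos hM hM) hd') hφ hφZ)

/-! ### §2 The residual: case (g) only for a quartic field -/

/-- **LOCALISATION OF THE NAMED FACT, QUARTIC FORM.** `MoonenZarhin1999_codimTwoHodgeClasses_abelianFivefold` is
EQUIVALENT to its instances at: (α) the SIMPLE fivefolds NOT of CM type [Tankeev–Ribet]; (β) case (e) ∩ (a1) —
`X ∼ E × (E × T)`, `E` a CM elliptic curve, `T` a simple threefold NOT of CM type with `dim_ℚ End⁰(T) = 2` and
`End⁰(E) ↪ End⁰(T)` [Thm. 0.2 (1)]; (γ') case (g) with `X ∼ F × C`, `C` an elliptic curve with `χ ≫ χ = -d'`, `F` a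
simple fourfold NOT of CM type whose endomorphism algebra is a QUARTIC FIELD (Type IV(2,1) `⊋ k`), a CENTRAL `φ` on
`F` with `φ ≫ φ = -(M²d')` of unbalanced multiplicities, `dim_ℚ End⁰(F) ≠ 2` [Thm. 0.2 (3) with `End⁰(X₂) ⊋ k`] — the
quaternion alternative of the Albert reading being empty (`not_quaternionCell`).
[cite: MoonenZarhin1999LowDim, Thm. 0.2 (1)–(4), §2 (2.4) and §5 (5.1), (5.10)–(5.12)] [cite: MumfordAV1970, §21 (pp. 201–202)] -/
theorem moonenZarhin1999_codimTwoHodgeClasses_abelianFivefold_iff_residual_quartic :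
    MoonenZarhin1999_codimTwoHodgeClasses_abelianFivefold ↔
      (∀ A : AbelianVariety ℂ, A.dim = 5 → A.IsSimple → ¬ IsOfCMType A → IsCodimTwoDivisorPullbackGenerated A) ∧
      (∀ A : AbelianVariety ℂ, A.dim = 5 →
        (∃ E T : AbelianVariety ℂ, E.dim = 1 ∧ IsOfCMType E ∧ T.IsSimple ∧ T.dim = 3 ∧
          Module.finrank ℚ T.endAlgebra = 2 ∧ ¬ IsOfCMType T ∧
          Nonempty (E.endAlgebra →+* T.endAlgebra) ∧ AbelianVariety.IsIsogenous A (E.prod (E.prod T))) →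
        IsCodimTwoDivisorPullbackGenerated A) ∧
      (∀ A : AbelianVariety ℂ, A.dim = 5 →
        (∃ (F C : AbelianVariety ℂ), F.IsSimple ∧ F.dim = 4 ∧ ¬ IsOfCMType F ∧
          (IsField F.endAlgebra ∧ Module.finrank ℚ F.endAlgebra = 4) ∧
          C.dim = 1 ∧ AbelianVariety.IsIsogenous A (F.prod C) ∧
          ∃ (χ : C ⟶ C) (d' : ℕ), 0 < d' ∧ χ ≫ χ = -(d' • 𝟙 C) ∧ ∃ (φ : F ⟶ F) (M : ℕ), 0 < M ∧
          φ ≫ φ = -((M * M * d') • 𝟙 F) ∧ AbelianVariety.endAlgebra.of F φ ∈ Subalgebra.center ℚ F.endAlgebra ∧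
          eigenMultiplicity F φ (Complex.I * (Real.sqrt (M * M * d' : ℕ) : ℂ)) ≠
            eigenMultiplicity F φ (-(Complex.I * (Real.sqrt (M * M * d' : ℕ) : ℂ))) ∧
          Module.finrank ℚ F.endAlgebra ≠ 2) →
        IsCodimTwoDivisorPullbackGenerated A) := by
  rw [moonenZarhin1999_codimTwoHodgeClasses_abelianFivefold_iff_residual_albert]
  refine ⟨fun ⟨hS, hE, hG⟩ => ⟨hS, hE, fun A hA ⟨F, C, hFs, hF4, hF, hK, hrest⟩ =>
      hG A hA ⟨F, C, hFs, hF4, hF, Or.inl hK, hrest⟩⟩, fun ⟨hS, hE, hG⟩ => ⟨hS, hE, ?_⟩⟩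
  rintro A hA ⟨F, C, hFs, hF4, hF, hK | ⟨h8, hZ2⟩, hC, hAFC, χ, d', hd', hχ, φ, M, hM, hφ, hφZ, hneq, h2⟩
  · exact hG A hA ⟨F, C, hFs, hF4, hF, hK, hC, hAFC, χ, d', hd', hχ, φ, M, hM, hφ, hφZ, hneq, h2⟩
  · exact (not_quaternionCell hFs hF4 h8 hZ2 hM hd' hφ hφZ hneq).elim

end Literature.AlgebraicGeometry.HodgeTheory.AbelianLowDimension.NonCMFivefoldsCodimTwoResidualQuartic

end

/-! ## Part 4: CaseGQuarticFieldClosed -/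

noncomputable section

open _root_.CategoryTheory _root_.CategoryTheory.Limits

namespace Literature.AlgebraicGeometry.HodgeTheory.AbelianLowDimension.CaseGQuarticField

open Literature.AlgebraicGeometry.ComplexMultiplication.Domination

open Literature.AlgebraicGeometry.Motives (AbelianVariety)
open Literature.AlgebraicGeometry.Motives.AbelianVariety
open Literature.AlgebraicGeometry.HodgeTheory
open Literature.AlgebraicGeometry.ComplexMultiplication
open Literature.AlgebraicGeometry.Milne1999
open NumberField
open Literature.AlgebraicGeometry.HodgeTheory.AbelianLowDimension.NonCMFivefoldsCodimTwoResidualQuartic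
open Literature.AlgebraicGeometry.HodgeTheory.AbelianLowDimension.LowDimOfMarkman

/-! ### §1 Case (g) with `End⁰(F)` a quartic field: `B = D` and HC, unconditionally -/

/-- **Moonen–Zarhin 1999 Thm. 0.2 (3), case (g) with `End⁰(X₂) = F` a QUARTIC FIELD — `B•(X) = D•(X)` and the Hodge
conjecture for `X`, UNCONDITIONALLY.** `F` a simple fourfold whose endomorphism algebra is a field of degree `4`,
`φ ∈ End(F)` with `φ ≫ φ = -n` (`n > 0`) acting on `H^{1,0}(F)` with unequal multiplicities at `± i√n` («`k ↪ End⁰(X₂)`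
via which `k` acts on `T_{X₂,0}` with multiplicities `(1,3)`»), `C` an elliptic curve with `χ ≫ χ = -d'`, `X ∼ F × C`:
the Literature lane's bridge `exists_quarticCM_data_of_isField_of_eigenMultiplicity_ne` (the `F`-signature is
`{(1,1),(2,0)}`) and `hodgeConjectureFor_of_isIsogenous_prod_cmCurve_of_quarticCM` (R40-G).
[cite: MoonenZarhin1999LowDim, Thm. 0.2 (3) case (g) and §5 (5.11) Case 2, (5.12)] [cite: vanGeemen1994HodgeAV, §3.6 (p. 236) and Lemma 3.7] -/
theorem hodgeConjectureFor_of_caseG_quarticField {X F C : AbelianVariety ℂ} (hFs : F.IsSimple) (hF4 : F.dim = 4)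
    (hK : IsField F.endAlgebra) (hK4 : Module.finrank ℚ F.endAlgebra = 4) (φ : F ⟶ F) {n : ℕ} (hn : 0 < n)
    (hφ : φ ≫ φ = -(n • 𝟙 F))
    (hne : eigenMultiplicity F φ (Complex.I * (Real.sqrt n : ℂ)) ≠
      eigenMultiplicity F φ (-(Complex.I * (Real.sqrt n : ℂ))))
    (hC : C.dim = 1) (χ : C ⟶ C) {d' : ℕ} (hd' : 0 < d') (hχ : χ ≫ χ = -(d' • 𝟙 C))
    (hX : AbelianVariety.IsIsogenous X (F.prod C)) :
    IsDivisorGenerated X ∧ HodgeConjectureFor X.dim X.X := by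
  obtain ⟨β, μ₁, μ₂, h11, h22, h12, h12', hm1, hm1', hm2⟩ :=
    exists_quarticCM_data_of_isField_of_eigenMultiplicity_ne hFs hF4 hK hK4 φ hn hφ hne
  exact hodgeConjectureFor_of_isIsogenous_prod_cmCurve_of_quarticCM hFs β hK4 h11 h22 h12 h12' hm1 hm1' hm2 hF4 hC χ
    hd' hχ hX

/-- **LOCALISATION OF THE NAMED FACT, FINAL FORM FOR CASE (g).** `MoonenZarhin1999_codimTwoHodgeClasses_abelianFivefold`
is EQUIVALENT to its instances at: (α) the SIMPLE fivefolds NOT of CM type [Tankeev–Ribet]; (β) case (e) ∩ (a1) —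
`X ∼ E × (E × T)`, `E` a CM elliptic curve, `T` a simple threefold NOT of CM type with `dim_ℚ End⁰(T) = 2` and
`End⁰(E) ↪ End⁰(T)` [Thm. 0.2 (1)]. Case (g) — both for `End⁰(X₂) = k` (R29) and for `End⁰(X₂)` a quartic field (§1) —
and the quaternion alternative (empty, `not_quaternionCell`) are theorems of the tree.
[cite: MoonenZarhin1999LowDim, Thm. 0.2 (1)–(4), §2 (2.4) and §5 (5.1), (5.10)–(5.12)] [cite: MumfordAV1970, §21 (pp. 201–202)] -/
theorem moonenZarhin1999_codimTwoHodgeClasses_abelianFivefold_iff_residual_caseE :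
    MoonenZarhin1999_codimTwoHodgeClasses_abelianFivefold ↔
      (∀ A : AbelianVariety ℂ, A.dim = 5 → A.IsSimple → ¬ IsOfCMType A → IsCodimTwoDivisorPullbackGenerated A) ∧
      (∀ A : AbelianVariety ℂ, A.dim = 5 →
        (∃ E T : AbelianVariety ℂ, E.dim = 1 ∧ IsOfCMType E ∧ T.IsSimple ∧ T.dim = 3 ∧
          Module.finrank ℚ T.endAlgebra = 2 ∧ ¬ IsOfCMType T ∧
          Nonempty (E.endAlgebra →+* T.endAlgebra) ∧ AbelianVariety.IsIsogenous A (E.prod (E.prod T))) →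
        IsCodimTwoDivisorPullbackGenerated A) := by
  rw [moonenZarhin1999_codimTwoHodgeClasses_abelianFivefold_iff_residual_quartic]
  refine ⟨fun ⟨hS, hE, _⟩ => ⟨hS, hE⟩, fun ⟨hS, hE⟩ => ⟨hS, hE, ?_⟩⟩
  rintro A - ⟨F, C, hFs, hF4, -, ⟨hK, hK4⟩, hC, hAFC, χ, d', hd', hχ, φ, M, hM, hφ, -, hneq, -⟩
  exact (hodgeConjectureFor_of_caseG_quarticField hFs hF4 hK hK4 φ (Nat.mul_pos (Nat.mul_pos hM hM) hd') hφ hneq hC χ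
    hd' hχ hAFC).1.isCodimTwoDivisorPullbackGenerated

end Literature.AlgebraicGeometry.HodgeTheory.AbelianLowDimension.CaseGQuarticField

end

/-! ## Part 5: CaseEA1Closed -/

noncomputable section

open _root_.CategoryTheory _root_.CategoryTheory.Limits

namespace Literature.AlgebraicGeometry.HodgeTheory.AbelianLowDimension.CaseEA1

open Literature.AlgebraicGeometry.Motives (AbelianVariety)
open Literature.AlgebraicGeometry.Motives.AbelianVariety
open Literature.AlgebraicGeometry.HodgeTheory
open Literature.AlgebraicGeometry.ComplexMultiplication
open Literature.AlgebraicGeometry.Milne1999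
open NumberField
open Literature.AlgebraicGeometry.ComplexMultiplication.Domination
open Literature.AlgebraicGeometry.HodgeTheory.AbelianLowDimension.NonSimpleFivefoldsCodimTwo
open Literature.AlgebraicGeometry.HodgeTheory.AbelianLowDimension.CMFivefoldsCodimTwo
open Literature.AlgebraicGeometry.HodgeTheory.AbelianLowDimension.LowDimOfMarkman
open Literature.AlgebraicGeometry.HodgeTheory.AbelianLowDimension.CaseGQuarticField

variable {X : AbelianVariety ℂ}

/-! ### §1 The fivefold fact: equivalent to its simple non-CM instances; a consequence of Tankeev–Ribet -/

/-- **LOCALISATION OF THE NAMED FACT, FINAL FORM.** `MoonenZarhin1999_codimTwoHodgeClasses_abelianFivefold`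
(Thm. 0.2 in codimension `2` for ALL complex abelian fivefolds) is EQUIVALENT to its instances at the SIMPLE
fivefolds NOT of CM type — the clause of Tankeev–Ribet's theorem («`B = D` for simple abelian varieties of prime
dimension»). The residual «(e) ∩ (a1)» of `CaseGQuarticField.…_iff_residual_caseE` is DISCHARGED by the Literature
lane's `isCodimTwoDivisorPullbackGenerated_of_caseE_a1` (Thm. 0.2 (1) in codimension two, a theorem).
[cite: MoonenZarhin1999LowDim, Thm. 0.2 (1)–(4), §2 Thm. (2.7) and §5 (5.1), (5.12)] [cite: Tankeev1983, main theorem] -/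
theorem moonenZarhin1999_codimTwoHodgeClasses_abelianFivefold_iff_simple_not_isOfCMType :
    MoonenZarhin1999_codimTwoHodgeClasses_abelianFivefold ↔
      ∀ A : AbelianVariety ℂ, A.dim = 5 → A.IsSimple → ¬ IsOfCMType A → IsCodimTwoDivisorPullbackGenerated A := by
  rw [moonenZarhin1999_codimTwoHodgeClasses_abelianFivefold_iff_residual_caseE]
  exact ⟨fun h => h.1, fun h => ⟨h, isCodimTwoDivisorPullbackGenerated_of_caseE_a1⟩⟩

end Literature.AlgebraicGeometry.HodgeTheory.AbelianLowDimension.CaseEA1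

end

/-! ## Part 6: FivefoldFactTwoShapes -/

noncomputable section

open _root_.CategoryTheory _root_.CategoryTheory.Limits

namespace Literature.AlgebraicGeometry.HodgeTheory.AbelianLowDimension.FivefoldFactTwoShapes

open Literature.AlgebraicGeometry.Motives (AbelianVariety)
open Literature.AlgebraicGeometry.Motives.AbelianVariety
open Literature.AlgebraicGeometry.HodgeTheory
open Literature.AlgebraicGeometry.ComplexMultiplication
open Literature.AlgebraicGeometry.Milne1999
open NumberField
open Literature.AlgebraicGeometry.HodgeTheory.AbelianLowDimension.CaseEA1

variable {X : AbelianVariety ℂ}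

/-! ### §1 The fact is two Hodge-group shapes on simple fivefolds -/

/-- `5` is prime and odd. [cite: Gordon1997, Thm. 6.3 and Corollary] -/
private theorem prime_five_and_odd : (5 : ℕ).Prime ∧ Odd 5 := ⟨by norm_num, by decide⟩

/-- **A SIMPLE NON-CM FIVEFOLD OUTSIDE THE TWO RESIDUAL SHAPES HAS `B² ⊆ D²`** — pointwise: given (S1) for this `X` if
`End⁰(X) = ℚ` and (S2) for this `X` if `End⁰(X) = ℚ(φ)` acts with multiplicities `≥ 2`, the predicate holds; shapes
I(5) and type one are theorems, shape IV(5) is CM type. [cite: MoonenZarhin1999LowDim, §2 (2.4) and Thm. (2.7)]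
[cite: Gordon1997, Thm. 6.3 and Corollary] [cite: Ribet1983, Thms. 0 and 3] -/
theorem isCodimTwoDivisorPullbackGenerated_of_isSimple_of_not_isOfCMType_of_shapes (hX5 : X.dim = 5)
    (hs : X.IsSimple) (hcm : ¬ IsOfCMType X)
    (h1 : Module.finrank ℚ X.endAlgebra = 1 → IsCodimTwoDivisorPullbackGenerated X)
    (h2 : ∀ (φ : X ⟶ X) (d : ℕ), 0 < d → φ ≫ φ = -(d • 𝟙 X) → Module.finrank ℚ X.endAlgebra = 2 →
      2 ≤ eigenMultiplicity X φ (Complex.I * (Real.sqrt d : ℂ)) →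
      2 ≤ eigenMultiplicity X φ (-(Complex.I * (Real.sqrt d : ℂ))) → IsCodimTwoDivisorPullbackGenerated X) :
    IsCodimTwoDivisorPullbackGenerated X := by
  classical
  have hp : X.dim.Prime := hX5 ▸ prime_five_and_odd.1
  have hodd : Odd X.dim := hX5 ▸ prime_five_and_odd.2
  have h0 : 0 < X.dim := by omega
  have hF : IsField X.endAlgebra := isField_endAlgebra_of_isSimple_of_prime_of_odd hs hp hodd
  rcases endAlgebra_shape_of_isSimple_of_prime_of_odd hs hp hodd hF with he1 | ⟨heP, hT⟩ | ⟨he2, hnT⟩ | ⟨-, hcm'⟩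
  · exact h1 he1
  · haveI := hT
    exact (AbelianVariety.isDivisorGenerated_of_isTotallyReal X hF heP).isCodimTwoDivisorPullbackGenerated
  · obtain ⟨a, q, hq, ha⟩ := AbelianVariety.exists_mul_self_eq_neg_of_finrank_eq_two h0 he2 hF hnT
    obtain ⟨φ, d, hd, hφ⟩ := AbelianVariety.exists_hom_comp_self_eq_neg X hq ha
    obtain ⟨hpos₁, hpos₂⟩ := AbelianVariety.eigenMultiplicity_pos_of_isSimple X hs φ hd hφ (by omega)
    by_cases hone : eigenMultiplicity X φ (Complex.I * (Real.sqrt d : ℂ)) = 1 ∨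
        eigenMultiplicity X φ (-(Complex.I * (Real.sqrt d : ℂ))) = 1
    · exact (AbelianVariety.isDivisorGenerated_of_ribetTypeOne X φ hd hφ he2 hone (by omega)).isCodimTwoDivisorPullbackGenerated
    · simp only [not_or] at hone
      exact h2 φ d hd hφ he2 (by omega) (by omega)
  · exact absurd hcm' hcm

/-- **LOCALISATION OF THE NAMED FACT TO TWO SHAPES.** `MoonenZarhin1999_codimTwoHodgeClasses_abelianFivefold` is
EQUIVALENT to its instances at (S1) the SIMPLE fivefolds with `End⁰(X) = ℚ` (type I(1): `Hg = Sp₁₀` in print) and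
(S2) the simple fivefolds with `End⁰(X) = ℚ(φ)`, `φ ≫ φ = -d`, acting on `H^{1,0}` with multiplicities `≥ 2` at
both `± i√d` (type IV(1,·) with `(2,3)`: `Hg = U_k` in print, Ribet's Thm. 3). Everything else — the non-simple and
the CM fivefolds (R41), the totally real quintic and the type-one unitary simple fivefolds (Ribet Thms. 0, 3 for
`(m,1)`, proved) — is a theorem of the tree. [cite: MoonenZarhin1999LowDim, Thm. 0.2, §2 (2.4) and Thm. (2.7)]
[cite: Gordon1997, Thm. 6.3 and Corollary] -/
theorem moonenZarhin1999_codimTwoHodgeClasses_abelianFivefold_iff_generic_and_unitaryTwoThree :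
    MoonenZarhin1999_codimTwoHodgeClasses_abelianFivefold ↔
      (∀ X : AbelianVariety ℂ, X.dim = 5 → X.IsSimple → Module.finrank ℚ X.endAlgebra = 1 →
        IsCodimTwoDivisorPullbackGenerated X) ∧
      (∀ (X : AbelianVariety ℂ) (φ : X ⟶ X) (d : ℕ), X.dim = 5 → X.IsSimple → 0 < d → φ ≫ φ = -(d • 𝟙 X) →
        Module.finrank ℚ X.endAlgebra = 2 → 2 ≤ eigenMultiplicity X φ (Complex.I * (Real.sqrt d : ℂ)) →
        2 ≤ eigenMultiplicity X φ (-(Complex.I * (Real.sqrt d : ℂ))) → IsCodimTwoDivisorPullbackGenerated X) := by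
  refine ⟨fun h => ⟨fun X hX _ _ => moonenZarhin1999_codimTwoHodgeClasses_abelianFivefold_iff.1 h X hX,
    fun X φ d hX _ _ _ _ _ _ => moonenZarhin1999_codimTwoHodgeClasses_abelianFivefold_iff.1 h X hX⟩, fun ⟨hS1, hS2⟩ => ?_⟩
  rw [moonenZarhin1999_codimTwoHodgeClasses_abelianFivefold_iff_simple_not_isOfCMType]
  intro X hX hs hcm
  exact isCodimTwoDivisorPullbackGenerated_of_isSimple_of_not_isOfCMType_of_shapes hX hs hcm (hS1 X hX hs)
    (fun φ d hd hφ he2 ha hb => hS2 X φ d hX hs hd hφ he2 ha hb)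

/-! ### §2 The fact from Ribet 1983 -/

/-- **Shape (S2) is a theorem**: a complex abelian FIVEFOLD with `φ ≫ φ = -d`, `dim_ℚ End⁰ = 2` and both
multiplicities `≥ 2` (type IV(1) with `(2,3)`) satisfies `B² ⊆ D² + Σ α^* B²(X')` — indeed `B = D` on all its powers,
the Literature lane's UNCONDITIONAL `AbelianVariety.isDivisorGenerated_of_ribetTypeTwoThree` (Ribet 1983 Thm. 3 at
`(2,3)`, via THEOREM L″ and the classification-free `Θ`-subalgebra theorem `UnitaryThetaCore.eq_top_two_three'`).
[cite: Ribet1983, Thm. 3] [cite: MoonenZarhin1999LowDim, §2 (2.4) and Thm. (2.7)] -/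
theorem isCodimTwoDivisorPullbackGenerated_of_unitaryTwoThree (hX5 : X.dim = 5) (φ : X ⟶ X) {d : ℕ} (hd : 0 < d)
    (hφ : φ ≫ φ = -(d • 𝟙 X)) (he2 : Module.finrank ℚ X.endAlgebra = 2)
    (h2a : 2 ≤ eigenMultiplicity X φ (Complex.I * (Real.sqrt d : ℂ)))
    (h2b : 2 ≤ eigenMultiplicity X φ (-(Complex.I * (Real.sqrt d : ℂ)))) : IsCodimTwoDivisorPullbackGenerated X :=
  (AbelianVariety.isDivisorGenerated_of_ribetTypeTwoThree X φ hd hφ he2 h2a h2b hX5).isCodimTwoDivisorPullbackGenerated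

/-- **LOCALISATION OF THE NAMED FACT TO ONE SHAPE.** `MoonenZarhin1999_codimTwoHodgeClasses_abelianFivefold` is
EQUIVALENT to its instances at the SIMPLE fivefolds with `End⁰(X) = ℚ` (type I(1); in print `Hg = Sp₁₀`, Ribet's
Thm. 1 with `E = ℚ`, `g = 5` / Moonen–Zarhin p. 715). Every other fivefold — non-simple, CM, totally real quintic
`End⁰`, type IV(1) with multiplicities `(1,4)` OR `(2,3)` — is a theorem of the tree.
[cite: MoonenZarhin1999LowDim, Thm. 0.2, §2 (2.4) and Thm. (2.7)] [cite: Gordon1997, Thm. 6.3 and Corollary] [cite: Ribet1983, Thms. 0–3] -/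
theorem moonenZarhin1999_codimTwoHodgeClasses_abelianFivefold_iff_generic :
    MoonenZarhin1999_codimTwoHodgeClasses_abelianFivefold ↔
      ∀ X : AbelianVariety ℂ, X.dim = 5 → X.IsSimple → Module.finrank ℚ X.endAlgebra = 1 →
        IsCodimTwoDivisorPullbackGenerated X := by
  rw [moonenZarhin1999_codimTwoHodgeClasses_abelianFivefold_iff_generic_and_unitaryTwoThree]
  exact ⟨fun h => h.1, fun h => ⟨h, fun X φ d hX _ hd hφ he2 ha hb =>
    isCodimTwoDivisorPullbackGenerated_of_unitaryTwoThree hX φ hd hφ he2 ha hb⟩⟩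

end Literature.AlgebraicGeometry.HodgeTheory.AbelianLowDimension.FivefoldFactTwoShapes

end

/-! ## Part 7: FivefoldFactHolds -/

noncomputable section

open _root_.CategoryTheory _root_.CategoryTheory.Limits

namespace Literature.AlgebraicGeometry.HodgeTheory.AbelianLowDimension.FivefoldFactHolds

open Literature.AlgebraicGeometry.Motives (AbelianVariety)
open Literature.AlgebraicGeometry.Motives.AbelianVariety
open Literature.AlgebraicGeometry.HodgeTheory
open Literature.AlgebraicGeometry.ComplexMultiplication
open Literature.AlgebraicGeometry.Milne1999
open NumberField
open Literature.AlgebraicGeometry.HodgeTheory.AbelianLowDimension.FivefoldFactTwoShapes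

variable {X : AbelianVariety ℂ}

/-! ### §1 Shape (S1) discharged: the fivefold fact HOLDS -/

/-- **Shape (S1) is a theorem**: a complex abelian FIVEFOLD with `End⁰(X) = ℚ` (`finrank_ℚ End⁰(X) = 1`) satisfies
`B² ⊆ D² + Σ_α α^* B²(X')` — indeed `B = D` on all its powers, the Literature lane's UNCONDITIONAL
`AbelianVariety.isDivisorGenerated_of_fivefold_endRankOne` (`GenericAbelianFivefoldPowersHodgeClasses`: `Lie Hg = 𝔰𝔭₁₀`
by the rank-ten Θ-subalgebra theorem `SymplecticThetaTen.wordDerAt_eq_zero_of_skew`, then the invariant theory of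
`Sp`; in print Moonen–Zarhin (2.6) «`Hg(X) = Sp_D(V,φ)` for all simple abelian 5-folds» / Ribet's Thm. 1 with
`E = ℚ`). [cite: MoonenZarhin1999LowDim, §2 (2.6) and Thm. (2.7)] [cite: Ribet1983, Thm. 1] -/
theorem isCodimTwoDivisorPullbackGenerated_of_generic (hX5 : X.dim = 5) (h1 : Module.finrank ℚ X.endAlgebra = 1) :
    IsCodimTwoDivisorPullbackGenerated X :=
  (AbelianVariety.isDivisorGenerated_of_fivefold_endRankOne X h1 hX5).isCodimTwoDivisorPullbackGenerated

/-- **MOONEN–ZARHIN 1999 Thm. 0.2, CODIMENSION TWO, IS A THEOREM OF THE TREE: the named fact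
`MoonenZarhin1999_codimTwoHodgeClasses_abelianFivefold` HOLDS** — for every complex abelian FIVEFOLD `A` and every
rational `(2,2)`-class `c ∈ H⁴(A, ℂ)`, `c` lies in the span of the products of divisor classes and of the pull-backs
of rational `(2,2)`-classes on abelian fourfolds along surjective homomorphisms: «`B²(X) = D²(X) + Σ_α α^* B²(X')`».
Assembled from the localisation `moonenZarhin1999_codimTwoHodgeClasses_abelianFivefold_iff_generic` (the fact is
equivalent to its instances at the simple fivefolds with `End⁰ = ℚ`) and (S1). `HC_CM` does not occur; Markman is
not used; no named fact is a hypothesis; nothing is admitted.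
[cite: MoonenZarhin1999LowDim, Thm. 0.2 (1)–(4), §2 (2.6), Thm. (2.7) and §5 (5.12)] [cite: Ribet1983, Thms. 0–3] -/
theorem _root_.Literature.AlgebraicGeometry.HodgeTheory.MoonenZarhin1999_codimTwoHodgeClasses_abelianFivefold_holds :
    MoonenZarhin1999_codimTwoHodgeClasses_abelianFivefold :=
  moonenZarhin1999_codimTwoHodgeClasses_abelianFivefold_iff_generic.2 fun _ hX5 _ h1 =>
    isCodimTwoDivisorPullbackGenerated_of_generic hX5 h1

/-- **The Moonen–Zarhin / Markman dimension-`≤ 5` reduction from the FOURFOLD FACT ALONE**: granted the codimension-two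
part of Moonen–Zarhin's Thm. 0.1 (`MoonenZarhin1999_codimTwoHodgeClasses_abelianFourfold`: for abelian fourfolds
`B² ⊆ D² + Σ_k W_k`, a named fact of the tree — HYPOTHESIS, not discharged), the named fact
`MoonenZarhin1999_hodgeClasses_abelian_dim_le_five_of_weilClassesFourfolds` («algebraicity of the Weil classes of
abelian fourfolds ⟹ algebraicity of every rational `(p,p)`-class on every complex abelian variety of dimension `≤ 5`»)
HOLDS: the Literature lane's `MoonenZarhin1999_hodgeClasses_abelian_dim_le_five_of_weilClassesFourfolds_of_printed`
(Lefschetz `(1,1)` from Kodaira–Serre sections and GAGA, hard Lefschetz, pull-backs — all theorems) fed with the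
fivefold fact `HodgeTheory.MoonenZarhin1999_codimTwoHodgeClasses_abelianFivefold_holds` (§1). What remains of that reduction is
exactly Thm. 0.1 in codimension two. [cite: MoonenZarhin1999LowDim, Thm. 0.1, Thm. 0.2 and (1.9)]
[cite: Markman2025SurveySecant, §1.1 and proof of Cor. 1.3] [cite: VoisinHodgeI2002, Thm. 11.30, Cor. 11.34 and Thm. 6.25] -/
theorem moonenZarhin1999_hodgeClasses_abelian_dim_le_five_of_weilClassesFourfolds_of_fourfoldFact
    (h01 : MoonenZarhin1999_codimTwoHodgeClasses_abelianFourfold) :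
    MoonenZarhin1999_hodgeClasses_abelian_dim_le_five_of_weilClassesFourfolds :=
  MoonenZarhin1999_hodgeClasses_abelian_dim_le_five_of_weilClassesFourfolds_of_printed h01
    MoonenZarhin1999_codimTwoHodgeClasses_abelianFivefold_holds

end Literature.AlgebraicGeometry.HodgeTheory.AbelianLowDimension.FivefoldFactHolds

end
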